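import Literature.Algebra.EuclideanDomain.EuclideanOrderTypeEqLength
import Literature.Algebra.EuclideanDomain.ProductOfSmallEuclideanRings
import Literature.Order.Ordinal.NaturalSumOmegaMultiples
import HarnessLib

/-!
# Small Euclidean rings: `e(∏ᵢ₌₁ʳ Rᵢ × A) = rω + ℓ(A)`, and every `0 < α < ω²` is a Euclidean order type
# (Clark 2015, Thm. 27 (a), (b); Thm. 25 (c))

Topic `Literature/Algebra/EuclideanDomain`, namespace `Literature.Algebra.EuclideanDomain`.  THEOREMS ONLY (no `def`, no
instance, no named fact), all proved, in the vocabulary of `TransfiniteSmallestAlgorithm.lean` (`samuelSet R α = A_α`,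
`samuelRank = θ`; «Euclidean» = exhausted by the transfinite construction) and `EuclideanOrderTypeIndecomposable.lean`
(`e(R) = ⨆ z, ((θ z − 1) + 1)`).  Resolves the `TODO(general form)` «`r` factors and an Artinian part `A` (`e = rω + ℓ(A)`)»
of `ProductOfSmallEuclideanRings.lean` (which computed `e(R × S) = ω + ω` for TWO small unbounded factors by hand): with the
Product Theorem's two bounds (`EuclideanOrderTypeProduct.lean`: `e(R) + e(S) ≤ e(R × S)`; `EuclideanOrderTypeProductUpperBound.lean`:
`e(R × S) ≤ e(R) ⊕ e(S)`), Hessenberg's formula `ω·m ⊕ ω·n = ω·(m + n)` (`Literature/Order/Ordinal/NaturalSumOmegaMultiples.lean`)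
and Thm. 25 (a) `e(R′ × A) = e(R′) + ℓ(A)` (`EuclideanOrderTypeEqLength.lean`).

## Source (read at the page)

P. L. Clark, *A note on Euclidean order types*, Order **32** (2015) 157–178 [Clark2015EuclideanOrderTypes] (materialised
`paper:arxiv-1208.0977`, arXiv numbering; `p0007.txt`), VERBATIM.  «We say a Euclidean ring `R ≅ ∏ᵢ₌₁ʳ Rᵢ × A(R)` is *small*
if `e(Rᵢ) = ω` for all `i`; otherwise we say `R` is *large*.  **Theorem 27.** a) Let `R ≅ ∏ᵢ₌₁ʳ Rᵢ × A` be a small Euclidean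
ring. Then `e(R) = rω + ℓ(A)`, where `n` [sic] is the length of the Artinian principal ring `A`. b) For every ordinal `α < ω²`,
there is a small Euclidean ring `R` with `e(R) = α`.  Proof. a) By Theorem 16 [Fletcher], `e(A) = ℓ(A) < ω`. Now we apply the
Product Theorem: `rω + ℓ(A) = e₁(R) + … + e_r(R) + e(A) ≤ e(R) ≤ ⊕ᵢ₌₁ʳ e(Rᵢ) ⊕ ℓ(A) = rω + ℓ(A)`. b) The ordinals less than `ω²`
are of the form `rω + n` for `r, n ∈ ω`. By part a), `e(ℂ[t]ʳ × ℂ[t]/(tⁿ)) = rω + n`.»  **Theorem 25.** «Let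
`R = ∏ᵢ₌₁ʳ Rᵢ × A = R′ × A` be a Euclidean ring. … c) `e(R′) ≥ rω`.  Proof. … c) By part b) and Theorem 22,
`rω ≤ e(R₁) + … + e(R_r) ≤ e(R′)`.»  (Clark's `rω` is the ordinal `ω·r`, `r` copies of `ω`.)

## What is formalised

* §1 **Thm. 25 (c): `ω·r ≤ e(∏ᵢ Rᵢ)`** for `r = |ι| ≥ 1` non-zero rings exhausted by their constructions with `e(Rᵢ) ≥ ω`
  (`Pi.omega0_mul_card_le_iSup_samuelRank`; Clark's `Rᵢ` are non-field Euclidean domains, which have `e ≥ ω`,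
  `omega0_le_iSup_samuelRank_of_not_isUnit`), by the lower bound of the Product Theorem along `∏_{Option ι} ≅ R_none × ∏_ι`.
* §2 **Thm. 27 (a) without Artinian part: `e(∏ᵢ Rᵢ) = ω·r`** when every `e(Rᵢ) = ω` (`Pi.iSup_samuelRank_eq_omega0_mul_card`:
  the two bounds `ω + ω·r′ ≤ e ≤ ω ⊕ ω·r′ = ω·(1 + r′)` meet), and **Thm. 27 (a): `e(∏ᵢ Rᵢ × A) = ω·r + ℓ(A)`** for a non-zero
  Artinian principal ideal ring `A` (`iSup_samuelRank_pi_prod_eq`); **Prop. 28** (`e(R) = ω` for a non-field Euclidean domain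
  with finite residue rings, `iSup_samuelRank_eq_omega0_of_finite_quotients`) and Thm. 27 (a) for such factors
  (`iSup_samuelRank_pi_prod_eq_of_finite_quotients`), `e(ℤʳ) = ω·r`, `e(ℤʳ × ℤ/pⁿℤ) = ω·r + n`.
* §3 **Thm. 27 (b): every ordinal `0 < α < ω²` is the Euclidean order type of a small Euclidean ring**, namely of
  `ℤʳ × ℤ/2ⁿℤ` for `α = ω·r + n` (`exists_ring_iSup_samuelRank_eq`; the cases `ℤʳ`, `ℤ/2ⁿℤ`, `ℤʳ × ℤ/2ⁿℤ`:
  `iSup_samuelRank_int_pi`, `iSup_samuelRank_int_pi_prod_zmod`; Clark uses `ℂ[t]` for `ℤ`).  In the tree's convention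
  `e(R) = ⨆ z (θ z − 1 + 1) ≥ 1` for every ring (the zero ring and fields have `e = 1`), so `α = 0` is excluded.

## Mathlib / tree search

Mathlib: `Fintype.induction_empty_option`, `RingEquiv.piOptionEquivProd`, `RingEquiv.piCongrLeft`, `RingEquiv.prodZeroRing`,
`Pi.nontrivial`, `Ordinal.div_add_mod`, `Ordinal.lt_mul_iff_div_lt`, `Fintype.card_fin`.  Tree: `iSup_samuelRank_add_iSup_samuelRank_le_prod`,
`omega0_le_iSup_samuelRank_of_not_isUnit` (`EuclideanOrderTypeProduct.lean`), `Prod.iSup_samuelRank_le_nadd`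
(`EuclideanOrderTypeProductUpperBound.lean`), `nadd_omega0_omega0_mul_natCast` (`NaturalSumOmegaMultiples.lean`),
`iSup_samuelRank_eq_of_ringEquiv`, `Prod.iSup_samuelRank_eq_add_length`, `ZMod.iSup_samuelRank_primePow`, `ZMod.length_primePow`
(`EuclideanOrderTypeEqLength.lean`), `Prod.forall_exists_mem_samuelSet`, `Pi.forall_exists_mem_samuelSet` (`ProductOfEuclideanRings.lean`),
`forall_exists_mem_samuelSet_natCast_of_finite_quotients` (`ProductOfSmallEuclideanRings.lean`), `forall_samuelRank_lt_omega0_iff_iSup_le`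
(`EuclideanOrderTypeAtMostOmega.lean`),
`Int.forall_exists_mem_samuelSet`, `Int.iSup_samuelRank_eq_omega0`, `ZMod.forall_exists_mem_samuelSet`; `ProductOfSmallEuclideanRings.lean`
(`Prod.iSup_samuelRank_eq_of_small`: the case `r = 2`, `A = 0`, by a direct computation of `θ`).
-/

namespace Literature.Algebra.EuclideanDomain

open Ordinal Literature.Order.Ordinal

universe u

/-! ## §1 Thm. 25 (c): `ω·r ≤ e(∏ᵢ₌₁ʳ Rᵢ)` -/

section LowerBound

/-- **Thm. 25 (c) «`e(R′) ≥ rω`»** for `R′ = ∏ᵢ Rᵢ` a product of `r = |ι| ≥ 1` non-zero rings exhausted by their constructions,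
each of Euclidean order type `≥ ω` (e.g. non-field Euclidean domains): «`rω ≤ e(R₁) + … + e(R_r) ≤ e(R′)`» (lower bound of the
Product Theorem, induction on the number of factors). [cite: Clark2015EuclideanOrderTypes, Thm. 25 (c) and Thm. 22 (b)] -/
theorem Pi.omega0_mul_card_le_iSup_samuelRank {ι : Type u} [Fintype ι] [Nonempty ι] {A : ι → Type u}
    [∀ i, CommRing (A i)] [∀ i, Nontrivial (A i)] (h : ∀ i, ∀ x : A i, ∃ α : Ordinal.{u}, x ∈ samuelSet (A i) α)
    (hω : ∀ i, ω ≤ ⨆ x : A i, (samuelRank x - 1 + 1)) :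
    ω * (Fintype.card ι : Ordinal.{u}) ≤ ⨆ z : (Π i, A i), (samuelRank z - 1 + 1) := by
  let P : ∀ (α : Type u) [Fintype α], Prop := fun α _ ↦
    ∀ (B : α → Type u) [∀ i, CommRing (B i)] [∀ i, Nontrivial (B i)], Nonempty α →
      (∀ i, ∀ x : B i, ∃ β : Ordinal.{u}, x ∈ samuelSet (B i) β) →
        (∀ i, ω ≤ ⨆ x : B i, (samuelRank x - 1 + 1)) →
          ω * (Fintype.card α : Ordinal.{u}) ≤ ⨆ z : (Π i, B i), (samuelRank z - 1 + 1)
  suffices H : P ι from H A ‹_› h hω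
  refine Fintype.induction_empty_option (P := P) ?_ ?_ ?_ ι
  · intro α β _ e hα B _ _ hne hB hωB
    letI : Fintype α := .ofEquiv β e.symm
    have hα' := hα (fun a ↦ B (e a)) ⟨e.symm hne.some⟩ (fun a ↦ hB (e a)) (fun a ↦ hωB (e a))
    have hex : ∀ z : (Π a, B (e a)), ∃ γ : Ordinal.{u}, z ∈ samuelSet (Π a, B (e a)) γ :=
      Pi.forall_exists_mem_samuelSet (A := fun a ↦ B (e a)) (fun a ↦ hB (e a))
    rw [iSup_samuelRank_eq_of_ringEquiv (RingEquiv.piCongrLeft B e) hex, Fintype.card_congr e |>.symm]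
    convert hα' using 2
  · intro B _ _ hne
    exact (not_nonempty_iff.2 inferInstance hne).elim
  · intro α _ hα B _ _ _ hB hωB
    rcases isEmpty_or_nonempty α with hα0 | hα0
    · let ε : B none ≃+* (Π i, B i) :=
        (RingEquiv.prodZeroRing (B none) (Π a : α, B (some a))).trans (RingEquiv.piOptionEquivProd (R := B)).symm
      rw [iSup_samuelRank_eq_of_ringEquiv ε (hB none), Fintype.card_option, Fintype.card_eq_zero, zero_add, Nat.cast_one,
        mul_one]
      exact hωB none
    · obtain ⟨a₀⟩ := hα0
      letI : Inhabited α := ⟨a₀⟩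
      have IH := hα (fun a ↦ B (some a)) ⟨a₀⟩ (fun a ↦ hB (some a)) (fun a ↦ hωB (some a))
      have hexP : ∀ z : (Π a, B (some a)), ∃ β : Ordinal.{u}, z ∈ samuelSet (Π a, B (some a)) β :=
        Pi.forall_exists_mem_samuelSet (A := fun a ↦ B (some a)) (fun a ↦ hB (some a))
      let ε : (B none × Π a, B (some a)) ≃+* (Π i, B i) := (RingEquiv.piOptionEquivProd (R := B)).symm
      rw [iSup_samuelRank_eq_of_ringEquiv ε (Prod.forall_exists_mem_samuelSet (hB none) hexP), Fintype.card_option,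
        Nat.cast_succ, mul_add_one]
      calc ω * (Fintype.card α : Ordinal.{u}) + ω
          = ω + ω * (Fintype.card α : Ordinal.{u}) := by
            rw [← mul_one_add, ← mul_add_one, ← Nat.cast_succ, ← Nat.cast_one, ← Nat.cast_add, Nat.add_comm]
        _ ≤ (⨆ x : B none, (samuelRank x - 1 + 1)) + ⨆ z : (Π a, B (some a)), (samuelRank z - 1 + 1) :=
            add_le_add (hωB none) IH
        _ ≤ ⨆ z : B none × (Π a, B (some a)), (samuelRank z - 1 + 1) :=
            iSup_samuelRank_add_iSup_samuelRank_le_prod (hB none) hexP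

end LowerBound

/-! ## §2 Thm. 27 (a): `e(∏ᵢ₌₁ʳ Rᵢ) = ω·r` and `e(∏ᵢ₌₁ʳ Rᵢ × A) = ω·r + ℓ(A)` for small factors -/

section Small

/-- **Thm. 27 (a), no Artinian part: `e(∏ᵢ Rᵢ) = ω·r`** for `r = |ι| ≥ 1` non-zero rings exhausted by their constructions with
`e(Rᵢ) = ω` («small»): «`rω = e₁(R) + … + e_r(R) ≤ e(R) ≤ ⊕ᵢ₌₁ʳ e(Rᵢ) = rω`» — induction on the number of factors with
`ω + ω·r′ ≤ e(R_none × ∏) ≤ ω ⊕ ω·r′ = ω·(1 + r′)` (Hessenberg's formula). [cite: Clark2015EuclideanOrderTypes, Thm. 27 (a)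
and Thm. 22 (b)] -/
theorem Pi.iSup_samuelRank_eq_omega0_mul_card {ι : Type u} [Fintype ι] [Nonempty ι] {A : ι → Type u}
    [∀ i, CommRing (A i)] [∀ i, Nontrivial (A i)] (h : ∀ i, ∀ x : A i, ∃ α : Ordinal.{u}, x ∈ samuelSet (A i) α)
    (hω : ∀ i, (⨆ x : A i, (samuelRank x - 1 + 1)) = ω) :
    (⨆ z : (Π i, A i), (samuelRank z - 1 + 1)) = ω * (Fintype.card ι : Ordinal.{u}) := by
  let P : ∀ (α : Type u) [Fintype α], Prop := fun α _ ↦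
    ∀ (B : α → Type u) [∀ i, CommRing (B i)] [∀ i, Nontrivial (B i)], Nonempty α →
      (∀ i, ∀ x : B i, ∃ β : Ordinal.{u}, x ∈ samuelSet (B i) β) →
        (∀ i, (⨆ x : B i, (samuelRank x - 1 + 1)) = ω) →
          (⨆ z : (Π i, B i), (samuelRank z - 1 + 1)) = ω * (Fintype.card α : Ordinal.{u})
  suffices H : P ι from H A ‹_› h hω
  refine Fintype.induction_empty_option (P := P) ?_ ?_ ?_ ι
  · intro α β _ e hα B _ _ hne hB hωB
    letI : Fintype α := .ofEquiv β e.symm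
    have hα' := hα (fun a ↦ B (e a)) ⟨e.symm hne.some⟩ (fun a ↦ hB (e a)) (fun a ↦ hωB (e a))
    have hex : ∀ z : (Π a, B (e a)), ∃ γ : Ordinal.{u}, z ∈ samuelSet (Π a, B (e a)) γ :=
      Pi.forall_exists_mem_samuelSet (A := fun a ↦ B (e a)) (fun a ↦ hB (e a))
    rw [iSup_samuelRank_eq_of_ringEquiv (RingEquiv.piCongrLeft B e) hex, Fintype.card_congr e |>.symm]
    convert hα' using 2
  · intro B _ _ hne
    exact (not_nonempty_iff.2 inferInstance hne).elim
  · intro α _ hα B _ _ _ hB hωB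
    rcases isEmpty_or_nonempty α with hα0 | hα0
    · let ε : B none ≃+* (Π i, B i) :=
        (RingEquiv.prodZeroRing (B none) (Π a : α, B (some a))).trans (RingEquiv.piOptionEquivProd (R := B)).symm
      rw [iSup_samuelRank_eq_of_ringEquiv ε (hB none), hωB none, Fintype.card_option, Fintype.card_eq_zero, zero_add,
        Nat.cast_one, mul_one]
    · obtain ⟨a₀⟩ := hα0
      letI : Inhabited α := ⟨a₀⟩
      have IH := hα (fun a ↦ B (some a)) ⟨a₀⟩ (fun a ↦ hB (some a)) (fun a ↦ hωB (some a))
      have hexP : ∀ z : (Π a, B (some a)), ∃ β : Ordinal.{u}, z ∈ samuelSet (Π a, B (some a)) β :=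
        Pi.forall_exists_mem_samuelSet (A := fun a ↦ B (some a)) (fun a ↦ hB (some a))
      let ε : (B none × Π a, B (some a)) ≃+* (Π i, B i) := (RingEquiv.piOptionEquivProd (R := B)).symm
      rw [iSup_samuelRank_eq_of_ringEquiv ε (Prod.forall_exists_mem_samuelSet (hB none) hexP), Fintype.card_option]
      have hcast : ω * ((Fintype.card α + 1 : ℕ) : Ordinal.{u}) = ω * ((1 + Fintype.card α : ℕ) : Ordinal.{u}) := by
        rw [Nat.add_comm]
      apply le_antisymm
      · -- upper bound `e ≤ ω ⊕ ω·r′ = ω·(1 + r′)`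
        refine (Prod.iSup_samuelRank_le_nadd (hB none) hexP).trans_eq ?_
        rw [hωB none, IH, nadd_omega0_omega0_mul_natCast, hcast]
      · -- lower bound `ω·(1 + r′) = ω + ω·r′ ≤ e`
        refine le_trans ?_ (iSup_samuelRank_add_iSup_samuelRank_le_prod (hB none) hexP)
        rw [hωB none, IH, hcast, Nat.cast_add, Nat.cast_one, mul_one_add]

/-- **Prop. 28 «Let `R` be a Euclidean domain such that `R/(a)` is a finite ring for all `a ∈ R•`. Then `R` is small»**:
`e(R) = ω` for such a domain exhausted by its construction and not a field (every `θ(z)` is finite — the finite stages exhaust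
`R`, Samuel's Prop. 15 — so `e(R) ≤ ω`, and a non-unit gives `e(R) ≥ ω`). [cite: Clark2015EuclideanOrderTypes, Prop. 28] -/
theorem iSup_samuelRank_eq_omega0_of_finite_quotients {R : Type u} [CommRing R] [IsDomain R]
    (hfin : ∀ b : R, b ≠ 0 → Finite (R ⧸ Ideal.span {b})) (h : ∀ x : R, ∃ α : Ordinal.{u}, x ∈ samuelSet R α)
    (hx : ∃ x : R, x ≠ 0 ∧ ¬IsUnit x) : (⨆ z : R, (samuelRank z - 1 + 1)) = ω := by
  refine le_antisymm (forall_samuelRank_lt_omega0_iff_iSup_le.1 fun z ↦ ?_) ?_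
  · obtain ⟨n, hn⟩ := forall_exists_mem_samuelSet_natCast_of_finite_quotients hfin h z
    exact (samuelRank_le_of_mem hn).trans_lt (natCast_lt_omega0 n)
  · obtain ⟨x, hx0, hxu⟩ := hx
    exact omega0_le_iSup_samuelRank_of_not_isUnit h hx0 hxu

/-- Prop. 28 for a Mathlib `EuclideanDomain` with finite residue rings which is not a field: `e = ω` (`ℤ`, `ℤ[i]`, `𝔽_q[t]`, …).
[cite: Clark2015EuclideanOrderTypes, Prop. 28] -/
theorem iSup_samuelRank_eq_omega0_of_euclideanDomain_of_finite_quotients {S : Type u} [EuclideanDomain S]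
    (hfin : ∀ b : S, b ≠ 0 → Finite (S ⧸ Ideal.span {b})) (hx : ∃ x : S, x ≠ 0 ∧ ¬IsUnit x) :
    (⨆ z : S, (samuelRank z - 1 + 1)) = ω :=
  iSup_samuelRank_eq_omega0_of_finite_quotients hfin forall_exists_mem_samuelSet_of_euclideanDomain hx

/-- **`e(ℤʳ) = ω·r`** (`r ≥ 1`): `ℤ` is small, `e(ℤ) = ω`. [cite: Clark2015EuclideanOrderTypes, Thm. 27 (a) and §2.5 Example
(«`e(ℤ) = ω`»)] -/
theorem iSup_samuelRank_int_pi {r : ℕ} (hr : r ≠ 0) :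
    (⨆ z : (Fin r → ℤ), (samuelRank z - 1 + 1)) = ω * (r : Ordinal.{0}) := by
  haveI : Nonempty (Fin r) := ⟨⟨0, Nat.pos_of_ne_zero hr⟩⟩
  rw [Pi.iSup_samuelRank_eq_omega0_mul_card (fun _ ↦ Int.forall_exists_mem_samuelSet)
    (fun _ ↦ Int.iSup_samuelRank_eq_omega0), Fintype.card_fin]

/-- **Thm. 27 (a) «Let `R ≅ ∏ᵢ₌₁ʳ Rᵢ × A` be a small Euclidean ring. Then `e(R) = rω + ℓ(A)`»**: `r = |ι| ≥ 1` non-zero rings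
`Rᵢ` exhausted by their constructions with `e(Rᵢ) = ω`, `A` a non-zero Artinian principal ideal ring, `ℓ(A)` its (finite)
length `Module.length A A`. [cite: Clark2015EuclideanOrderTypes, Thm. 27 (a)] -/
theorem iSup_samuelRank_pi_prod_eq {ι : Type u} [Fintype ι] [Nonempty ι] {R : ι → Type u} [∀ i, CommRing (R i)]
    [∀ i, Nontrivial (R i)] (h : ∀ i, ∀ x : R i, ∃ α : Ordinal.{u}, x ∈ samuelSet (R i) α)
    (hω : ∀ i, (⨆ x : R i, (samuelRank x - 1 + 1)) = ω) (A : Type u) [CommRing A] [Nontrivial A] [IsArtinianRing A]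
    [IsPrincipalIdealRing A] :
    (⨆ z : (Π i, R i) × A, (samuelRank z - 1 + 1)) =
      ω * (Fintype.card ι : Ordinal.{u}) + ((Module.length A A).toNat : Ordinal.{u}) := by
  obtain ⟨i₀⟩ := ‹Nonempty ι›
  letI : Inhabited ι := ⟨i₀⟩
  rw [Prod.iSup_samuelRank_eq_add_length A (Pi.forall_exists_mem_samuelSet h), Pi.iSup_samuelRank_eq_omega0_mul_card h hω]

/-- **Thm. 27 (a) for Euclidean domains with finite residue rings** (Prop. 28: they are small): for `r = |ι| ≥ 1` non-field
Mathlib `EuclideanDomain`s `Rᵢ` with all `Rᵢ/(b)` finite and a non-zero Artinian PIR `A`, `e(∏ᵢ Rᵢ × A) = ω·r + ℓ(A)`.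
[cite: Clark2015EuclideanOrderTypes, Thm. 27 (a) and Prop. 28] -/
theorem iSup_samuelRank_pi_prod_eq_of_finite_quotients {ι : Type u} [Fintype ι] [Nonempty ι] {R : ι → Type u}
    [∀ i, EuclideanDomain (R i)] (hfin : ∀ i, ∀ b : R i, b ≠ 0 → Finite (R i ⧸ Ideal.span {b}))
    (hx : ∀ i, ∃ x : R i, x ≠ 0 ∧ ¬IsUnit x) (A : Type u) [CommRing A] [Nontrivial A] [IsArtinianRing A]
    [IsPrincipalIdealRing A] :
    (⨆ z : (Π i, R i) × A, (samuelRank z - 1 + 1)) =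
      ω * (Fintype.card ι : Ordinal.{u}) + ((Module.length A A).toNat : Ordinal.{u}) :=
  iSup_samuelRank_pi_prod_eq (fun i ↦ forall_exists_mem_samuelSet_of_euclideanDomain (R := R i))
    (fun i ↦ iSup_samuelRank_eq_omega0_of_euclideanDomain_of_finite_quotients (hfin i) (hx i)) A

/-- Thm. 27 (a) for `ℤʳ × ℤ/pⁿℤ`: **`e(ℤʳ × ℤ/pⁿℤ) = ω·r + n`** (`p` prime, `r, n ≥ 1`) — Clark's `e(ℂ[t]ʳ × ℂ[t]/(tⁿ)) = rω + n` with
`ℤ` for `ℂ[t]`. [cite: Clark2015EuclideanOrderTypes, Thm. 27 (a) and proof of (b)] -/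
theorem iSup_samuelRank_int_pi_prod_zmod {r : ℕ} (hr : r ≠ 0) {p : ℕ} (hp : p.Prime) {n : ℕ} (hn : n ≠ 0) :
    (⨆ z : (Fin r → ℤ) × ZMod (p ^ n), (samuelRank z - 1 + 1)) = ω * (r : Ordinal.{0}) + (n : Ordinal.{0}) := by
  haveI : Nonempty (Fin r) := ⟨⟨0, Nat.pos_of_ne_zero hr⟩⟩
  haveI : Fact (1 < p ^ n) := ⟨Nat.one_lt_pow hn hp.one_lt⟩
  haveI : IsPrincipalIdealRing (ZMod (p ^ n)) :=
    IsPrincipalIdealRing.of_surjective (Int.castRingHom (ZMod (p ^ n))) ZMod.intCast_surjective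
  haveI : IsArtinianRing (ZMod (p ^ n)) := isArtinian_of_finite
  rw [iSup_samuelRank_pi_prod_eq (fun _ ↦ Int.forall_exists_mem_samuelSet) (fun _ ↦ Int.iSup_samuelRank_eq_omega0),
    Fintype.card_fin, ZMod.length_primePow hp hn, ENat.toNat_coe]

end Small

/-! ## §3 Thm. 27 (b): every `0 < α < ω²` is a Euclidean order type -/

section Realisation

/-- The ordinals below `ω² = ω·ω` are the `ω·r + n`, `r, n` natural numbers («The ordinals less than `ω²` are of the form
`rω + n` for `r, n ∈ ω`»). [cite: Clark2015EuclideanOrderTypes, proof of Thm. 27 (b)] -/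
theorem lt_omega0_mul_omega0_iff {α : Ordinal.{u}} : α < ω * ω ↔ ∃ r n : ℕ, α = ω * r + n := by
  constructor
  · intro h
    obtain ⟨r, hr⟩ := Ordinal.lt_omega0.1 ((Ordinal.lt_mul_iff_div_lt omega0_ne_zero).1 h)
    obtain ⟨n, hn⟩ := Ordinal.lt_omega0.1 (Ordinal.mod_lt α omega0_ne_zero)
    exact ⟨r, n, by rw [← hr, ← hn, Ordinal.div_add_mod]⟩
  · rintro ⟨r, n, rfl⟩
    exact (lt_omega0_mul_natCast_iff.2 ⟨r, Nat.lt_succ_self r, n, rfl⟩).trans_le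
      (mul_le_mul_right (natCast_lt_omega0 (r + 1)).le _)

/-- **Thm. 27 (b) «For every ordinal `α < ω²`, there is a small Euclidean ring `R` with `e(R) = α`»** — for `0 < α = ω·r + n`:
`ℤ/2ⁿℤ` (`r = 0`), `ℤʳ` (`n = 0`), `ℤʳ × ℤ/2ⁿℤ` (Clark: `ℂ[t]ʳ × ℂ[t]/(tⁿ)`; all these are small: `e(ℤ) = ω`).  The ring is
Euclidean in the sense of the tree (exhausted by its transfinite construction, i.e. it carries an ordinal-valued algorithm)
and `e` is its Euclidean order type `⨆ z (θ z − 1 + 1)`; `α = 0` is not an order type in this convention (`e ≥ 1`).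
[cite: Clark2015EuclideanOrderTypes, Thm. 27 (b)] -/
theorem exists_ring_iSup_samuelRank_eq {α : Ordinal.{0}} (h0 : 0 < α) (hα : α < ω * ω) :
    ∃ (R : Type) (_ : CommRing R), (∀ x : R, ∃ β : Ordinal.{0}, x ∈ samuelSet R β) ∧
      (⨆ z : R, (samuelRank z - 1 + 1)) = α := by
  obtain ⟨r, n, rfl⟩ := lt_omega0_mul_omega0_iff.1 hα
  rcases Nat.eq_zero_or_pos r with rfl | hr
  · -- `α = n ≥ 1`: `ℤ/2ⁿℤ`
    have hn : n ≠ 0 := by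
      rintro rfl
      rw [Nat.cast_zero, mul_zero, add_zero] at h0
      exact lt_irrefl _ h0
    refine ⟨ZMod (2 ^ n), inferInstance, ZMod.forall_exists_mem_samuelSet (pow_ne_zero n two_ne_zero), ?_⟩
    rw [ZMod.iSup_samuelRank_primePow Nat.prime_two hn, Nat.cast_zero, mul_zero, zero_add]
  · rcases Nat.eq_zero_or_pos n with rfl | hn
    · -- `α = ω·r`: `ℤʳ`
      refine ⟨Fin r → ℤ, inferInstance, Pi.forall_exists_mem_samuelSet (fun _ ↦ Int.forall_exists_mem_samuelSet), ?_⟩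
      rw [iSup_samuelRank_int_pi hr.ne', Nat.cast_zero, add_zero]
    · -- `α = ω·r + n`: `ℤʳ × ℤ/2ⁿℤ`
      refine ⟨(Fin r → ℤ) × ZMod (2 ^ n), inferInstance,
        Prod.forall_exists_mem_samuelSet (Pi.forall_exists_mem_samuelSet fun _ ↦ Int.forall_exists_mem_samuelSet)
          (ZMod.forall_exists_mem_samuelSet (pow_ne_zero n two_ne_zero)), ?_⟩
      exact iSup_samuelRank_int_pi_prod_zmod hr.ne' Nat.prime_two hn.ne'

/-- Conversely every small Euclidean ring of the shape `ℤʳ × A` (`A` a non-zero Artinian PIR, `r ≥ 1`) has `e < ω²`: all the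
order types `ω·r + n` realised above lie below `ω·ω`. [cite: Clark2015EuclideanOrderTypes, Thm. 27 (a), (b)] -/
theorem omega0_mul_natCast_add_natCast_lt (r n : ℕ) : ω * (r : Ordinal.{u}) + n < ω * ω :=
  lt_omega0_mul_omega0_iff.2 ⟨r, n, rfl⟩

end Realisation

end Literature.Algebra.EuclideanDomain
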